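import Mathlib
import HarnessLib

/-!
# Route «KPlusLogSqLaw», `WeakLifting` (stmt-ValiantsHypothesis-19561) — integrals for the cube-root Loewner kernel:
# `∫₀^∞ μ³ dμ / ((a³ + μ³)(b³ + μ³)) = I / (a² + ab + b²)`, `I = ∫₀^∞ ds / (1 + s³)`

HONEST FRAMING.  Helper file (seat val-sym-lift-p4 g26, cell `pub-symmetroid`, 2026-08-29; `--supports 19561 --as helper`, zero crux
credit).  Pure real analysis, no statement about pencils: the Gram-integral representation of the kernel `1/(a² + ab + b²)` on `(0, ∞)`
(the Loewner matrix of `t ↦ t^{1/3}` at the points `a³, b³`), which the companion file `…MixedGaugeCubeLoewnerKernel` turns into the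
positive definiteness hypothesis `hK` of `MixedGauge.card_posZeros_le_blocks_of_cubeLoewner` (the two-class law at ratio 3).  Contents:
integrability on `(0,∞)` of the rational functions involved (domination by `M·(1 + μ²)⁻¹`); `integral_cube_scale`
(`∫ a³/(a³+μ³) = a·I`, substitution); `integral_pair_of_ne` (partial fractions, `a ≠ b`); `integral_pair_self` (`∫ μ³/(a³+μ³)² = I/(3a²)`,
fundamental theorem of calculus on `(0,∞)` with `G(μ) = −μ/(3(a³+μ³))`); `integral_pair` (both cases: `= I/(a² + ab + b²)`); `I_pos`.
Nothing here is about `WeakLifting` / `TropicalB`, the doors, `MatrixDescartes` (18050) or VP ≠ VNP.  No `def`; axioms standard.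
[folklore calculus]
-/

set_option linter.dupNamespace false
set_option autoImplicit false

namespace Summit.ValiantsHypothesis.ValiantsHypothesis.Theorems.KPlusLogSqLaw

open MeasureTheory Set Filter Topology
open scoped BigOperators

namespace MixedGauge

/-! ## 1. Integrability on `(0, ∞)` by domination with `M·(1 + μ²)⁻¹` -/

/-- a function continuous on `(0,∞)` and dominated there by `M·(1 + μ²)⁻¹` is integrable on `(0,∞)`. -/
theorem integrableOn_Ioi_of_le_inv_one_add_sq {f : ℝ → ℝ} (M : ℝ) (hf : ContinuousOn f (Ioi 0))
    (hle : ∀ μ ∈ Ioi (0:ℝ), |f μ| ≤ M * (1 + μ ^ 2)⁻¹) : IntegrableOn f (Ioi 0) := by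
  have hg : IntegrableOn (fun μ : ℝ => M * (1 + μ ^ 2)⁻¹) (Ioi 0) :=
    (integrable_inv_one_add_sq.const_mul M).integrableOn
  refine Integrable.mono' hg (hf.aestronglyMeasurable measurableSet_Ioi) ?_
  rw [ae_restrict_iff' measurableSet_Ioi]
  exact Filter.Eventually.of_forall fun μ hμ => by rw [Real.norm_eq_abs]; exact hle μ hμ

/-- `μ² ≤ μ³ + 1` for `μ ≥ 0`. -/
theorem sq_le_cube_add_one (μ : ℝ) (hμ : 0 ≤ μ) : μ ^ 2 ≤ μ ^ 3 + 1 := by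
  nlinarith [mul_nonneg hμ (sq_nonneg (μ - 1)), sq_nonneg (μ - 1 / 2)]

/-- the basic bound: `a³/(a³ + μ³) ≤ (a³ + 2)·(1 + μ²)⁻¹` for `a, μ > 0`. -/
theorem cube_ratio_le (a μ : ℝ) (ha : 0 < a) (hμ : 0 < μ) :
    a ^ 3 / (a ^ 3 + μ ^ 3) ≤ (a ^ 3 + 2) * (1 + μ ^ 2)⁻¹ := by
  have hD : 0 < a ^ 3 + μ ^ 3 := by positivity
  have h1 : 0 < 1 + μ ^ 2 := by positivity
  rw [← div_eq_mul_inv, div_le_div_iff₀ hD h1]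
  have := sq_le_cube_add_one μ hμ.le
  have ha3 : 0 < a ^ 3 := by positivity
  nlinarith [mul_nonneg ha3.le (sq_nonneg μ), mul_nonneg ha3.le hμ.le, pow_pos hμ 3]

/-- `1/(a³ + μ³)` is integrable on `(0,∞)` (`a > 0`). -/
theorem integrableOn_inv_cube (a : ℝ) (ha : 0 < a) : IntegrableOn (fun μ : ℝ => 1 / (a ^ 3 + μ ^ 3)) (Ioi 0) := by
  have ha3 : 0 < a ^ 3 := by positivity
  refine integrableOn_Ioi_of_le_inv_one_add_sq ((a ^ 3 + 2) / a ^ 3) ?_ ?_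
  · refine ContinuousOn.div continuousOn_const (by fun_prop) ?_
    intro μ hμ
    have : 0 < μ := hμ
    positivity
  · intro μ hμ
    have hμ' : 0 < μ := hμ
    have hD : 0 < a ^ 3 + μ ^ 3 := by positivity
    rw [abs_of_pos (by positivity)]
    have h := cube_ratio_le a μ ha hμ'
    have : 1 / (a ^ 3 + μ ^ 3) = (1 / a ^ 3) * (a ^ 3 / (a ^ 3 + μ ^ 3)) := by
      field_simp
    rw [this]
    calc (1 / a ^ 3) * (a ^ 3 / (a ^ 3 + μ ^ 3)) ≤ (1 / a ^ 3) * ((a ^ 3 + 2) * (1 + μ ^ 2)⁻¹) :=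
          mul_le_mul_of_nonneg_left h (by positivity)
      _ = (a ^ 3 + 2) / a ^ 3 * (1 + μ ^ 2)⁻¹ := by ring

/-- `a³/(a³ + μ³)` is integrable on `(0,∞)` (`a > 0`). -/
theorem integrableOn_cube_ratio (a : ℝ) (ha : 0 < a) :
    IntegrableOn (fun μ : ℝ => a ^ 3 / (a ^ 3 + μ ^ 3)) (Ioi 0) := by
  have h : IntegrableOn (fun μ : ℝ => a ^ 3 * (1 / (a ^ 3 + μ ^ 3))) (Ioi 0) :=
    (integrableOn_inv_cube a ha).const_mul (a ^ 3)
  refine IntegrableOn.congr_fun h ?_ measurableSet_Ioi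
  intro μ _
  simp only
  ring

/-- the pair integrand `μ³/((a³ + μ³)(b³ + μ³))` is integrable on `(0,∞)` (`a, b > 0`). -/
theorem integrableOn_pair (a b : ℝ) (ha : 0 < a) (hb : 0 < b) :
    IntegrableOn (fun μ : ℝ => μ ^ 3 / ((a ^ 3 + μ ^ 3) * (b ^ 3 + μ ^ 3))) (Ioi 0) := by
  have hb3 : 0 < b ^ 3 := by positivity
  refine integrableOn_Ioi_of_le_inv_one_add_sq ((b ^ 3 + 2) / b ^ 3) ?_ ?_
  · refine ContinuousOn.div (by fun_prop) (by fun_prop) ?_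
    intro μ hμ
    have : 0 < μ := hμ
    positivity
  · intro μ hμ
    have hμ' : 0 < μ := hμ
    have hA : 0 < a ^ 3 + μ ^ 3 := by positivity
    have hB : 0 < b ^ 3 + μ ^ 3 := by positivity
    rw [abs_of_nonneg (by positivity)]
    have h1 : μ ^ 3 / ((a ^ 3 + μ ^ 3) * (b ^ 3 + μ ^ 3)) ≤ 1 / (b ^ 3 + μ ^ 3) := by
      rw [div_le_div_iff₀ (by positivity) hB]
      nlinarith [pow_pos ha 3, pow_pos hμ' 3]
    have h2 := cube_ratio_le b μ hb hμ'
    have h3 : 1 / (b ^ 3 + μ ^ 3) = (1 / b ^ 3) * (b ^ 3 / (b ^ 3 + μ ^ 3)) := by field_simp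
    calc μ ^ 3 / ((a ^ 3 + μ ^ 3) * (b ^ 3 + μ ^ 3)) ≤ 1 / (b ^ 3 + μ ^ 3) := h1
      _ = (1 / b ^ 3) * (b ^ 3 / (b ^ 3 + μ ^ 3)) := h3
      _ ≤ (1 / b ^ 3) * ((b ^ 3 + 2) * (1 + μ ^ 2)⁻¹) := mul_le_mul_of_nonneg_left h2 (by positivity)
      _ = (b ^ 3 + 2) / b ^ 3 * (1 + μ ^ 2)⁻¹ := by ring

/-! ## 2. The scaling identity `∫ a³/(a³ + μ³) = a·I` -/

/-- `∫_{(0,∞)} a³/(a³ + μ³) dμ = a · ∫_{(0,∞)} ds/(1 + s³)` (`a > 0`; substitution `μ = a s`). -/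
theorem integral_cube_scale (a : ℝ) (ha : 0 < a) :
    ∫ μ in Ioi (0:ℝ), a ^ 3 / (a ^ 3 + μ ^ 3) = a * ∫ s in Ioi (0:ℝ), 1 / (1 + s ^ 3) := by
  have h := integral_comp_mul_left_Ioi (fun s : ℝ => 1 / (1 + s ^ 3)) 0 (inv_pos.mpr ha)
  simp only [mul_zero, inv_inv, smul_eq_mul] at h
  rw [← h]
  refine setIntegral_congr_fun measurableSet_Ioi ?_
  intro μ hμ
  have hμ' : 0 < μ := hμ
  have ha3 : a ^ 3 ≠ 0 := by positivity
  simp only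
  rw [mul_pow, inv_pow]
  field_simp

/-- `∫_{(0,∞)} dμ/(a³ + μ³) = I / a²`. -/
theorem integral_inv_cube (a : ℝ) (ha : 0 < a) :
    ∫ μ in Ioi (0:ℝ), 1 / (a ^ 3 + μ ^ 3) = (∫ s in Ioi (0:ℝ), 1 / (1 + s ^ 3)) / a ^ 2 := by
  have ha3 : a ^ 3 ≠ 0 := by positivity
  have h1 : ∫ μ in Ioi (0:ℝ), 1 / (a ^ 3 + μ ^ 3) = ∫ μ in Ioi (0:ℝ), (a ^ 3)⁻¹ * (a ^ 3 / (a ^ 3 + μ ^ 3)) := by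
    refine setIntegral_congr_fun measurableSet_Ioi ?_
    intro μ hμ
    have hμ' : 0 < μ := hμ
    simp only
    field_simp
  rw [h1, integral_const_mul, integral_cube_scale a ha]
  field_simp

/-! ## 3. The pair integral, `a ≠ b`: partial fractions -/

/-- `∫_{(0,∞)} μ³ dμ /((a³ + μ³)(b³ + μ³)) = I/(a² + ab + b²)` for `0 < a`, `0 < b`, `a ≠ b`. -/
theorem integral_pair_of_ne (a b : ℝ) (ha : 0 < a) (hb : 0 < b) (hab : a ≠ b) :
    ∫ μ in Ioi (0:ℝ), μ ^ 3 / ((a ^ 3 + μ ^ 3) * (b ^ 3 + μ ^ 3)) =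
      (∫ s in Ioi (0:ℝ), 1 / (1 + s ^ 3)) / (a ^ 2 + a * b + b ^ 2) := by
  have hab3 : b ^ 3 - a ^ 3 ≠ 0 := by
    intro h
    have h' : b ^ 3 = a ^ 3 := sub_eq_zero.mp h
    have := (pow_left_inj₀ hb.le ha.le (by norm_num : (3:ℕ) ≠ 0)).mp h'
    exact hab this.symm
  have hpt : ∀ μ ∈ Ioi (0:ℝ), μ ^ 3 / ((a ^ 3 + μ ^ 3) * (b ^ 3 + μ ^ 3)) =
      (b ^ 3 - a ^ 3)⁻¹ * (b ^ 3 / (b ^ 3 + μ ^ 3) - a ^ 3 / (a ^ 3 + μ ^ 3)) := by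
    intro μ hμ
    have hμ' : 0 < μ := hμ
    have hA : a ^ 3 + μ ^ 3 ≠ 0 := by positivity
    have hB : b ^ 3 + μ ^ 3 ≠ 0 := by positivity
    field_simp
    ring
  rw [setIntegral_congr_fun measurableSet_Ioi hpt, integral_const_mul,
    integral_sub (integrableOn_cube_ratio b hb) (integrableOn_cube_ratio a ha), integral_cube_scale b hb,
    integral_cube_scale a ha]
  have hq : a ^ 2 + a * b + b ^ 2 ≠ 0 := by positivity
  field_simp
  ring

/-! ## 4. The pair integral, `a = b`: fundamental theorem of calculus on `(0,∞)` -/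

/-- `∫_{(0,∞)} μ³ dμ /(a³ + μ³)² = I/(3a²)` (`a > 0`): `μ³/(a³+μ³)² = G'(μ) + 1/(3(a³+μ³))` with `G(μ) = −μ/(3(a³+μ³))`,
`G(0) = 0 = G(∞)`. -/
theorem integral_pair_self (a : ℝ) (ha : 0 < a) :
    ∫ μ in Ioi (0:ℝ), μ ^ 3 / ((a ^ 3 + μ ^ 3) * (a ^ 3 + μ ^ 3)) =
      (∫ s in Ioi (0:ℝ), 1 / (1 + s ^ 3)) / (3 * a ^ 2) := by
  have ha3 : 0 < a ^ 3 := by positivity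
  -- the primitive G and its derivative
  have hderiv : ∀ μ ∈ Ioi (0:ℝ), HasDerivAt (fun μ : ℝ => -μ / (3 * (a ^ 3 + μ ^ 3)))
      (((-1) * (3 * (a ^ 3 + μ ^ 3)) - (-μ) * (3 * (3 * μ ^ 2))) / (3 * (a ^ 3 + μ ^ 3)) ^ 2) μ := by
    intro μ hμ
    have hμ' : 0 < μ := hμ
    have hD : 3 * (a ^ 3 + μ ^ 3) ≠ 0 := by positivity
    have hnum : HasDerivAt (fun μ : ℝ => -μ) (-1) μ := (hasDerivAt_id' μ).neg
    have hden : HasDerivAt (fun μ : ℝ => 3 * (a ^ 3 + μ ^ 3)) (3 * (3 * μ ^ 2)) μ := by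
      have h := ((hasDerivAt_pow 3 μ).const_add (a ^ 3)).const_mul 3
      simpa using h
    exact hnum.div hden hD
  -- integrability of the derivative: |G'| ≤ 1/(a³ + μ³)
  have hG'int : IntegrableOn (fun μ : ℝ => ((-1) * (3 * (a ^ 3 + μ ^ 3)) - (-μ) * (3 * (3 * μ ^ 2))) /
      (3 * (a ^ 3 + μ ^ 3)) ^ 2) (Ioi 0) := by
    refine integrableOn_Ioi_of_le_inv_one_add_sq ((a ^ 3 + 2) / a ^ 3) ?_ ?_
    · refine ContinuousOn.div (by fun_prop) (by fun_prop) ?_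
      intro μ hμ
      have : 0 < μ := hμ
      positivity
    · intro μ hμ
      have hμ' : 0 < μ := hμ
      have hD : 0 < a ^ 3 + μ ^ 3 := by positivity
      have hbound : |((-1) * (3 * (a ^ 3 + μ ^ 3)) - (-μ) * (3 * (3 * μ ^ 2))) / (3 * (a ^ 3 + μ ^ 3)) ^ 2|
          ≤ 1 / (a ^ 3 + μ ^ 3) := by
        rw [abs_div, abs_of_pos (by positivity : (0:ℝ) < (3 * (a ^ 3 + μ ^ 3)) ^ 2), div_le_div_iff₀ (by positivity) hD]
        have habs : |(-1) * (3 * (a ^ 3 + μ ^ 3)) - (-μ) * (3 * (3 * μ ^ 2))| ≤ 3 * a ^ 3 + 6 * μ ^ 3 := by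
          rw [abs_le]
          constructor <;> nlinarith [pow_pos ha 3, pow_pos hμ' 3]
        calc |(-1) * (3 * (a ^ 3 + μ ^ 3)) - (-μ) * (3 * (3 * μ ^ 2))| * (a ^ 3 + μ ^ 3)
            ≤ (3 * a ^ 3 + 6 * μ ^ 3) * (a ^ 3 + μ ^ 3) := mul_le_mul_of_nonneg_right habs hD.le
          _ ≤ 1 * (3 * (a ^ 3 + μ ^ 3)) ^ 2 := by nlinarith [pow_pos ha 3, pow_pos hμ' 3]
      have h2 := cube_ratio_le a μ ha hμ'
      have h3 : 1 / (a ^ 3 + μ ^ 3) = (1 / a ^ 3) * (a ^ 3 / (a ^ 3 + μ ^ 3)) := by field_simp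
      calc _ ≤ 1 / (a ^ 3 + μ ^ 3) := hbound
        _ = (1 / a ^ 3) * (a ^ 3 / (a ^ 3 + μ ^ 3)) := h3
        _ ≤ (1 / a ^ 3) * ((a ^ 3 + 2) * (1 + μ ^ 2)⁻¹) := mul_le_mul_of_nonneg_left h2 (by positivity)
        _ = (a ^ 3 + 2) / a ^ 3 * (1 + μ ^ 2)⁻¹ := by ring
  -- G → 0 at ∞ and G continuous at 0⁺ with G 0 = 0
  have hcont : ContinuousWithinAt (fun μ : ℝ => -μ / (3 * (a ^ 3 + μ ^ 3))) (Ici 0) 0 := by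
    refine ContinuousAt.continuousWithinAt ?_
    refine ContinuousAt.div (by fun_prop) (by fun_prop) ?_
    positivity
  have htend : Tendsto (fun μ : ℝ => -μ / (3 * (a ^ 3 + μ ^ 3))) atTop (𝓝 0) := by
    have hg : Tendsto (fun μ : ℝ => (μ ^ 2)⁻¹) atTop (𝓝 0) :=
      tendsto_inv_atTop_zero.comp (tendsto_pow_atTop two_ne_zero)
    refine squeeze_zero_norm' ?_ hg
    filter_upwards [eventually_gt_atTop (0:ℝ)] with μ hμ
    rw [Real.norm_eq_abs, abs_div, abs_neg, abs_of_pos hμ, abs_of_pos (by positivity : (0:ℝ) < 3 * (a ^ 3 + μ ^ 3)),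
      div_le_iff₀ (by positivity : (0:ℝ) < 3 * (a ^ 3 + μ ^ 3))]
    have hμ2 : 0 < μ ^ 2 := by positivity
    rw [inv_mul_eq_div, le_div_iff₀ hμ2]
    nlinarith [pow_pos ha 3, pow_pos hμ 3]
  have hFTC := integral_Ioi_of_hasDerivAt_of_tendsto hcont hderiv hG'int htend
  simp only [neg_zero, zero_div, sub_zero] at hFTC
  -- μ³/(a³+μ³)² = G' + (1/3)/(a³+μ³)
  have hpt : ∀ μ ∈ Ioi (0:ℝ), μ ^ 3 / ((a ^ 3 + μ ^ 3) * (a ^ 3 + μ ^ 3)) =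
      ((-1) * (3 * (a ^ 3 + μ ^ 3)) - (-μ) * (3 * (3 * μ ^ 2))) / (3 * (a ^ 3 + μ ^ 3)) ^ 2
        + (1 / 3) * (1 / (a ^ 3 + μ ^ 3)) := by
    intro μ hμ
    have hμ' : 0 < μ := hμ
    have hD : a ^ 3 + μ ^ 3 ≠ 0 := by positivity
    field_simp
    ring
  rw [setIntegral_congr_fun measurableSet_Ioi hpt, integral_add hG'int ((integrableOn_inv_cube a ha).const_mul _),
    hFTC, integral_const_mul, integral_inv_cube a ha]
  field_simp
  ring

/-! ## 5. Both cases, and positivity of `I` -/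

/-- `∫_{(0,∞)} μ³ dμ /((a³ + μ³)(b³ + μ³)) = I/(a² + ab + b²)` for all `a, b > 0`. -/
theorem integral_pair (a b : ℝ) (ha : 0 < a) (hb : 0 < b) :
    ∫ μ in Ioi (0:ℝ), μ ^ 3 / ((a ^ 3 + μ ^ 3) * (b ^ 3 + μ ^ 3)) =
      (∫ s in Ioi (0:ℝ), 1 / (1 + s ^ 3)) / (a ^ 2 + a * b + b ^ 2) := by
  by_cases hab : a = b
  · subst hab
    rw [integral_pair_self a ha]
    congr 1
    ring
  · exact integral_pair_of_ne a b ha hb hab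

/-- `I = ∫_{(0,∞)} ds/(1 + s³) > 0`. -/
theorem I_pos : 0 < ∫ s in Ioi (0:ℝ), 1 / (1 + s ^ 3) := by
  have hint : IntegrableOn (fun s : ℝ => 1 / (1 + s ^ 3)) (Ioi 0) := by
    have h := integrableOn_inv_cube 1 one_pos
    simpa using h
  rw [setIntegral_pos_iff_support_of_nonneg_ae ?_ hint]
  · have hsupp : Function.support (fun s : ℝ => 1 / (1 + s ^ 3)) ∩ Ioi 0 = Ioi 0 := by
      ext s
      simp only [mem_inter_iff, Function.mem_support, mem_Ioi, ne_eq, one_div, inv_eq_zero]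
      constructor
      · exact fun h => h.2
      · intro hs
        exact ⟨by positivity, hs⟩
    rw [hsupp, Real.volume_Ioi]
    exact ENNReal.zero_lt_top
  · rw [EventuallyLE, ae_restrict_iff' measurableSet_Ioi]
    exact Filter.Eventually.of_forall fun s hs => by
      have : (0:ℝ) < s := hs
      simp only [Pi.zero_apply]
      positivity

end MixedGauge

end Summit.ValiantsHypothesis.ValiantsHypothesis.Theorems.KPlusLogSqLaw
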